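import Mathlib
import HarnessLib
import Literature.NumberTheory.LFunctions.BourgainTheorem4
import Literature.NumberTheory.QuadraticFields.BinaryQuadraticFormsRoots
import Literature.NumberTheory.Sieve.DivisorBound

/-!
# Bourgain's discrete `L⁶` restriction estimate for the parabola (PROVED)

Topic `Literature/NumberTheory/LFunctions` (the decoupling cone of Bourgain's bound
`|ζ(1/2 + it)| ≪ t^{13/84 + ε}`, next to `BourgainTheorem4*.lean`, `BourgainTheorem2Induction.lean`,
`BourgainBilinearReduction.lean`). For a finite set `S ⊂ [-N, N]` of integers and complex
coefficients `a_n`,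

  `∫₀¹ ∫₀¹ |∑_{n ∈ S} a_n e(n u + n² w)|⁶ du dw ≤ C_ε N^ε (∑_{n ∈ S} |a_n|²)³`

(`discreteRestriction_parabola_L6`), i.e. `‖∑ a_n e(nu + n²w)‖_{L⁶(𝕋²)} ≪ N^ε ‖a‖_{ℓ²}`, the
periodic Strichartz / discrete restriction bound of J. Bourgain (Geom. Funct. Anal. 3 (1993)) for the
parabola, in the form recorded in J. Bourgain, *Decoupling, exponential sums and the Riemann zeta
function*, J. Amer. Math. Soc. 30 (2017), Remark after (1.4)–(1.5) ("the following discrete version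
of (1.5) … `≪ N^ε ‖a_n‖_{ℓ²}`", §2) and used at the end of the proof of (2.10) there (§3: "the
`L⁶`-norms are bounded by the `ℓ²`-norms of the coefficients (see Remark 1.4)"). It is the last
input of the chain (2.1)–(2.10) behind the hypothesis `h210` of
`Literature.NumberTheory.LFunctions.Bourgain2017_corollary3_of_eq210`.

Proof (the classical one): by orthogonality on `[0,1]²` (`integral_integral_normSq_expSum`,
Parseval for a finite exponential sum with frequencies in `ℤ²`) the left side equals
`∑_{(k,l)} |∑_{n₁+n₂+n₃ = k, n₁²+n₂²+n₃² = l} a_{n₁} a_{n₂} a_{n₃}|²`, so by Cauchy–Schwarz it is at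
most `max_{k,l} r(k,l) · (∑ |a_n|²)³` with `r(k, l)` the number of such triples in `S³`
(`sum_normSq_fiber_le`). The substitution `(x, y) = (n₁ - n₂, n₂ - n₃)` maps these triples
injectively to the representations of `(3l - k²)/2` by `x² + xy + y²` (`card_tripleFiber_le`),
and the number of representations of `m ≥ 1` by `x² + xy + y²` is at most `#Aut⁺ · τ(m)²`
(`card_A2box_le`): scaling by `gcd(x, y)` reduces to proper representations, which the tree's
Gauss–Dirichlet correspondence (`BinaryQuadraticFormsRoots.lean`: `card_filter_reps_rootOf_eq`)
counts by `#Aut⁺` times the number of roots of `t² + t + 1 ≡ 0 (mod m)` (`card_reps_le`), and that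
congruence has at most `τ(m)` roots (`card_qroots_one_one_le`: for a fixed root `t₀` the map
`t ↦ gcd(t - t₀, m)` is injective). The divisor bound `τ(m) ≪ m^δ`
(`Literature.NumberTheory.Sieve.exists_card_divisors_le_mul_rpow`) finishes the proof.

Everything here is PROVED (Mathlib + the tree); no definition and no named fact is introduced.

## References

* J. Bourgain, *Decoupling, exponential sums and the Riemann zeta function*, J. Amer. Math. Soc.
  30 (2017), 205–224 — Remark (1.4)–(1.5) (discrete version), §3 (2.9)–(2.10). [BourgainJAMS2017]
* J. Bourgain, *Fourier transform restriction phenomena for certain lattice subsets and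
  applications to nonlinear evolution equations. I. Schrödinger equations*, Geom. Funct. Anal. 3
  (1993), 107–156 — the `L⁶(𝕋²)` Strichartz bound with `N^ε` loss via the divisor bound (original
  source; statement-level reference).
* D. A. Cox, *Primes of the form x² + ny²*, 2nd ed., Wiley 2013, §2.A (Lemma 2.3, Thm. 2.8), as
  formalised in `Literature/NumberTheory/QuadraticFields/BinaryQuadraticFormsRoots.lean`. [Cox2013]
* G. H. Hardy, E. M. Wright, *An Introduction to the Theory of Numbers*, 6th ed., Thm 315
  (`d(n) = O(n^δ)`), as formalised in `Literature/NumberTheory/Sieve/DivisorBound.lean`.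
-/

noncomputable section

open Finset MeasureTheory intervalIntegral Complex
open scoped Real
open Literature.NumberTheory.QuadraticFields.Quadratic

namespace Literature.NumberTheory.LFunctions
namespace ParabolaRestriction


/-! ### Parseval on the two-torus for finite exponential sums -/

/-- Continuity of `w ↦ e(m w)`. [folklore] -/
theorem continuous_cexp_int_mul (m : ℤ) :
    Continuous fun w : ℝ => Complex.exp (2 * π * I * (m : ℂ) * (w : ℂ)) := by
  fun_prop

/-- Pointwise expansion of `|∑_f c_f e(f₁u + f₂w)|²` as a double sum over pairs of frequencies.
[folklore] -/
theorem normSq_expSum_eq (Φ : Finset (ℤ × ℤ)) (c : ℤ × ℤ → ℂ) (u w : ℝ) :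
    (((‖∑ f ∈ Φ, c f * Complex.exp (2 * π * I * ↑(((f.1 : ℤ) : ℝ) * u + ((f.2 : ℤ) : ℝ) * w))‖ ^ 2 : ℝ)) : ℂ)
      = ∑ f ∈ Φ, ∑ f' ∈ Φ, c f * (starRingEnd ℂ) (c f') *
          (Complex.exp (2 * π * I * ((f.1 - f'.1 : ℤ) : ℂ) * (u : ℂ)) *
            Complex.exp (2 * π * I * ((f.2 - f'.2 : ℤ) : ℂ) * (w : ℂ))) := by
  rw [← Complex.normSq_eq_norm_sq, ← Complex.mul_conj, map_sum, Finset.sum_mul_sum]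
  refine Finset.sum_congr rfl fun f _ => Finset.sum_congr rfl fun f' _ => ?_
  have hconj : (starRingEnd ℂ) (Complex.exp (2 * π * I * ↑(((f'.1 : ℤ) : ℝ) * u + ((f'.2 : ℤ) : ℝ) * w))) =
      Complex.exp (-(2 * π * I * ↑(((f'.1 : ℤ) : ℝ) * u + ((f'.2 : ℤ) : ℝ) * w))) := by
    rw [← Complex.exp_conj]
    congr 1
    simp only [map_mul, map_ofNat, Complex.conj_ofReal, Complex.conj_I]
    ring
  rw [map_mul, hconj]
  calc c f * Complex.exp (2 * π * I * ↑(((f.1 : ℤ) : ℝ) * u + ((f.2 : ℤ) : ℝ) * w)) *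
        ((starRingEnd ℂ) (c f') * Complex.exp (-(2 * π * I * ↑(((f'.1 : ℤ) : ℝ) * u + ((f'.2 : ℤ) : ℝ) * w))))
      = c f * (starRingEnd ℂ) (c f') * (Complex.exp (2 * π * I * ↑(((f.1 : ℤ) : ℝ) * u + ((f.2 : ℤ) : ℝ) * w)) *
          Complex.exp (-(2 * π * I * ↑(((f'.1 : ℤ) : ℝ) * u + ((f'.2 : ℤ) : ℝ) * w)))) := by ring
    _ = _ := by
      rw [← Complex.exp_add, ← Complex.exp_add]
      congr 1
      push_cast
      ring

/-- `∫₀¹ (A e(m u)) du = A [m = 0]`. [folklore] -/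
theorem integral_const_mul_cexp (A : ℂ) (m : ℤ) :
    ∫ y in (0 : ℝ)..1, A * Complex.exp (2 * π * I * (m : ℂ) * (y : ℂ)) =
      A * (if m = 0 then 1 else 0) := by
  rw [intervalIntegral.integral_const_mul, intervalIntegral_cexp_two_pi_mul_int]

/-- **Parseval on `[0,1]²` for a finite exponential sum with integer frequencies**:
`∫₀¹∫₀¹ |∑_f c_f e(f₁ u + f₂ w)|² du dw = ∑_f |c_f|²` (distinct `f ∈ ℤ²`). [folklore] -/
theorem integral_integral_normSq_expSum (Φ : Finset (ℤ × ℤ)) (c : ℤ × ℤ → ℂ) :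
    ∫ u in (0 : ℝ)..1, ∫ w in (0 : ℝ)..1,
        ‖∑ f ∈ Φ, c f * Complex.exp (2 * π * I * ↑(((f.1 : ℤ) : ℝ) * u + ((f.2 : ℤ) : ℝ) * w))‖ ^ 2
      = ∑ f ∈ Φ, ‖c f‖ ^ 2 := by
  apply Complex.ofReal_injective
  rw [← intervalIntegral.integral_ofReal]
  have hinner : ∀ u : ℝ, ((∫ w in (0 : ℝ)..1,
      ‖∑ f ∈ Φ, c f * Complex.exp (2 * π * I * ↑(((f.1 : ℤ) : ℝ) * u + ((f.2 : ℤ) : ℝ) * w))‖ ^ 2 : ℝ) : ℂ)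
      = ∑ f ∈ Φ, ∑ f' ∈ Φ, c f * (starRingEnd ℂ) (c f') *
          Complex.exp (2 * π * I * ((f.1 - f'.1 : ℤ) : ℂ) * (u : ℂ)) *
            (if f.2 - f'.2 = 0 then 1 else 0) := by
    intro u
    rw [← intervalIntegral.integral_ofReal]
    simp_rw [normSq_expSum_eq]
    rw [intervalIntegral.integral_finsetSum (fun f _ => ?_)]
    · refine Finset.sum_congr rfl fun f _ => ?_
      rw [intervalIntegral.integral_finsetSum (fun f' _ => ?_)]
      · refine Finset.sum_congr rfl fun f' _ => ?_
        simp_rw [← mul_assoc]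
        exact integral_const_mul_cexp _ _
      · exact (Continuous.intervalIntegrable (by fun_prop) _ _)
    · exact (Continuous.intervalIntegrable (by fun_prop) _ _)
  simp_rw [hinner]
  rw [intervalIntegral.integral_finsetSum (fun f _ => ?_)]
  · have hdiag : ∀ f ∈ Φ, (∫ u in (0 : ℝ)..1, ∑ f' ∈ Φ, c f * (starRingEnd ℂ) (c f') *
        Complex.exp (2 * π * I * ((f.1 - f'.1 : ℤ) : ℂ) * (u : ℂ)) *
          (if f.2 - f'.2 = 0 then 1 else 0)) = ((‖c f‖ ^ 2 : ℝ) : ℂ) := by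
      intro f hf
      rw [intervalIntegral.integral_finsetSum (fun f' _ => ?_)]
      · have hterm : ∀ f' ∈ Φ, (∫ u in (0 : ℝ)..1, c f * (starRingEnd ℂ) (c f') *
            Complex.exp (2 * π * I * ((f.1 - f'.1 : ℤ) : ℂ) * (u : ℂ)) *
              (if f.2 - f'.2 = 0 then 1 else 0)) =
            if f = f' then c f * (starRingEnd ℂ) (c f') else 0 := by
          intro f' _
          have e1 : (fun u : ℝ => c f * (starRingEnd ℂ) (c f') *
              Complex.exp (2 * π * I * ((f.1 - f'.1 : ℤ) : ℂ) * (u : ℂ)) *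
                (if f.2 - f'.2 = 0 then (1 : ℂ) else 0)) =
              fun u : ℝ => (c f * (starRingEnd ℂ) (c f') * (if f.2 - f'.2 = 0 then (1 : ℂ) else 0)) *
                Complex.exp (2 * π * I * ((f.1 - f'.1 : ℤ) : ℂ) * (u : ℂ)) := by
            funext u; ring
          rw [e1, integral_const_mul_cexp]
          by_cases h : f = f'
          · subst h
            simp
          · rw [if_neg h]
            have : f.1 - f'.1 ≠ 0 ∨ f.2 - f'.2 ≠ 0 := by
              by_contra hh
              push Not at hh
              exact h (Prod.ext (sub_eq_zero.1 hh.1) (sub_eq_zero.1 hh.2))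
            rcases this with h1 | h2
            · rw [if_neg h1]; ring
            · rw [if_neg h2]; ring
        rw [Finset.sum_congr rfl hterm, Finset.sum_ite_eq, if_pos hf, Complex.mul_conj,
          Complex.normSq_eq_norm_sq]
      · exact (Continuous.intervalIntegrable (by fun_prop) _ _)
    rw [Finset.sum_congr rfl hdiag]
    push_cast
    rfl
  · exact (Continuous.intervalIntegrable (by fun_prop) _ _)



/-! ### Roots of `t² + t + 1 ≡ 0 (mod E)`: at most `τ(E)` of them -/

/-- `t² + t + 1` is never divisible by `9`. [folklore] -/
theorem not_nine_dvd_sq_add_add_one (t : ℤ) : ¬ (9 : ℤ) ∣ t ^ 2 + t + 1 := by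
  have key : ∀ s : ZMod 9, s ^ 2 + s + 1 ≠ 0 := by decide
  intro h
  apply key (t : ZMod 9)
  have h' : ((t ^ 2 + t + 1 : ℤ) : ZMod 9) = 0 :=
    (ZMod.intCast_zmod_eq_zero_iff_dvd _ 9).2 (by exact_mod_cast h)
  push_cast at h'
  exact h'

/-- A common divisor of `2t + 1` and `t² + t + 1` divides `3` (`4(t²+t+1) - (2t+1)² = 3`).
[folklore] -/
theorem dvd_three_of_dvd_of_dvd {q t : ℤ} (h1 : q ∣ 2 * t + 1) (h2 : q ∣ t ^ 2 + t + 1) :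
    q ∣ 3 := by
  have : (3 : ℤ) = 4 * (t ^ 2 + t + 1) - (2 * t + 1) * (2 * t + 1) := by ring
  rw [this]
  exact dvd_sub (dvd_mul_of_dvd_right h2 _) (dvd_mul_of_dvd_right h1 _)

/-- **Key step.** If `t₀, t, t'` are roots of `s² + s + 1 ≡ 0 (mod E)` and
`gcd(t - t₀, E) = gcd(t' - t₀, E)`, then `t ≡ t' (mod E)`: writing `d` for the common gcd and
`E = d E₁`, one has `d ∣ t - t'` and `E₁ ∣ t - t'`, so `t' = t + jL` with `L = lcm(d, E₁)`,
`E = gL`, `g = gcd(d, E₁)`; the root condition for `t'` gives `g ∣ j(2t+1)`, and `gcd(g, 2t+1) = 1`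
because a common prime would be `3` and force `9 ∣ E ∣ t₀² + t₀ + 1`. [folklore] -/
theorem dvd_sub_of_gcd_eq {E : ℕ} (hE : 0 < E) {t₀ t t' : ℤ}
    (ht₀ : (E : ℤ) ∣ t₀ ^ 2 + t₀ + 1) (ht : (E : ℤ) ∣ t ^ 2 + t + 1)
    (ht' : (E : ℤ) ∣ t' ^ 2 + t' + 1)
    (hd : Int.gcd (t - t₀) E = Int.gcd (t' - t₀) E) : (E : ℤ) ∣ t - t' := by
  have hE0 : (E : ℤ) ≠ 0 := by exact_mod_cast hE.ne'
  set d : ℕ := Int.gcd (t - t₀) E with hd_def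
  have hdpos : 0 < d := Int.gcd_pos_of_ne_zero_right _ hE0
  have hd0 : (d : ℤ) ≠ 0 := by exact_mod_cast hdpos.ne'
  obtain ⟨E₁, hE₁⟩ : (d : ℤ) ∣ (E : ℤ) := Int.gcd_dvd_right _ _
  obtain ⟨A, hA⟩ : (d : ℤ) ∣ t - t₀ := Int.gcd_dvd_left _ _
  obtain ⟨A', hA'⟩ : (d : ℤ) ∣ t' - t₀ := by
    have h := Int.gcd_dvd_left (t' - t₀) (E : ℤ)
    rwa [← hd] at h
  -- the cofactors are prime to `E₁`
  have hcopA : Int.gcd A E₁ = 1 := by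
    have h1 : Int.gcd (t - t₀) E = d := rfl
    rw [hA, hE₁, Int.gcd_mul_left, Int.natAbs_natCast] at h1
    exact (mul_eq_left₀ hdpos.ne').1 h1
  have hcopA' : Int.gcd A' E₁ = 1 := by
    have h1 : Int.gcd (t' - t₀) E = d := hd.symm
    rw [hA', hE₁, Int.gcd_mul_left, Int.natAbs_natCast] at h1
    exact (mul_eq_left₀ hdpos.ne').1 h1
  have hE₁pos : 0 < E₁ := by
    have h1 : (0 : ℤ) < d * E₁ := by rw [← hE₁]; exact_mod_cast hE
    exact pos_of_mul_pos_right h1 (by positivity)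
  -- `E ∣ (s - t₀)(s + t₀ + 1)` for every root `s`
  have hprod : ∀ s : ℤ, (E : ℤ) ∣ s ^ 2 + s + 1 → (E : ℤ) ∣ (s - t₀) * (s + t₀ + 1) := by
    intro s hs
    have : (s - t₀) * (s + t₀ + 1) = (s ^ 2 + s + 1) - (t₀ ^ 2 + t₀ + 1) := by ring
    rw [this]
    exact dvd_sub hs ht₀
  have hE₁t : E₁ ∣ t + t₀ + 1 := by
    have h1 := hprod t ht
    rw [hE₁, hA, mul_assoc] at h1
    have h2 : E₁ ∣ A * (t + t₀ + 1) := (mul_dvd_mul_iff_left hd0).1 h1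
    exact Int.dvd_of_dvd_mul_right_of_gcd_one h2 (by rw [Int.gcd_comm]; exact hcopA)
  have hE₁t' : E₁ ∣ t' + t₀ + 1 := by
    have h1 := hprod t' ht'
    rw [hE₁, hA', mul_assoc] at h1
    have h2 : E₁ ∣ A' * (t' + t₀ + 1) := (mul_dvd_mul_iff_left hd0).1 h1
    exact Int.dvd_of_dvd_mul_right_of_gcd_one h2 (by rw [Int.gcd_comm]; exact hcopA')
  have hdtt : (d : ℤ) ∣ t - t' := by
    have : t - t' = (t - t₀) - (t' - t₀) := by ring
    rw [this, hA, hA']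
    exact dvd_sub (dvd_mul_right _ _) (dvd_mul_right _ _)
  have hE₁tt : E₁ ∣ t - t' := by
    have : t - t' = (t + t₀ + 1) - (t' + t₀ + 1) := by ring
    rw [this]
    exact dvd_sub hE₁t hE₁t'
  -- the lcm `L` and the gcd `g` of `d` and `E₁`
  set L : ℕ := Int.lcm (d : ℤ) E₁ with hL_def
  set g : ℕ := Int.gcd (d : ℤ) E₁ with hg_def
  have hLdvd : (L : ℤ) ∣ t - t' := Int.coe_lcm_dvd hdtt hE₁tt
  have hgL : (g : ℤ) * (L : ℤ) = (E : ℤ) := by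
    have h1 := Int.gcd_mul_lcm (d : ℤ) E₁
    rw [Int.natAbs_natCast] at h1
    have h2 : ((Int.gcd (d : ℤ) E₁ * Int.lcm (d : ℤ) E₁ : ℕ) : ℤ) = ((d * E₁.natAbs : ℕ) : ℤ) := by
      rw [h1]
    push_cast at h2
    rw [abs_of_pos hE₁pos] at h2
    rw [h2, hE₁]
  have hL0 : (L : ℤ) ≠ 0 := by
    have : L ≠ 0 := Int.lcm_ne_zero hd0 hE₁pos.ne'
    exact_mod_cast this
  have hgdvdL : (g : ℤ) ∣ (L : ℤ) :=
    (Int.gcd_dvd_left (d : ℤ) E₁).trans (Int.dvd_lcm_left (d : ℤ) E₁)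
  obtain ⟨j, hj⟩ : (L : ℤ) ∣ t' - t := dvd_sub_comm.1 hLdvd
  have hdiff : (E : ℤ) ∣ (t' - t) * (t' + t + 1) := by
    have : (t' - t) * (t' + t + 1) = (t' ^ 2 + t' + 1) - (t ^ 2 + t + 1) := by ring
    rw [this]
    exact dvd_sub ht' ht
  have hg1 : (g : ℤ) ∣ j * (2 * t + 1) := by
    rw [← hgL, hj] at hdiff
    have h1 : (g : ℤ) ∣ j * (t' + t + 1) := by
      have e1 : (L : ℤ) * j * (t' + t + 1) = L * (j * (t' + t + 1)) := by ring
      rw [e1, mul_comm (g : ℤ) L] at hdiff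
      exact (mul_dvd_mul_iff_left hL0).1 hdiff
    have ht'eq : t' = t + L * j := by linear_combination hj
    have h2 : j * (t' + t + 1) = j * (2 * t + 1) + j * j * L := by rw [ht'eq]; ring
    rw [h2] at h1
    have h3 : (g : ℤ) ∣ j * j * L := dvd_mul_of_dvd_right hgdvdL _
    exact (dvd_add_left h3).1 h1
  have hcop : Int.gcd (g : ℤ) (2 * t + 1) = 1 := by
    set q : ℕ := Int.gcd (g : ℤ) (2 * t + 1) with hq_def
    have hq1 : (q : ℤ) ∣ (g : ℤ) := Int.gcd_dvd_left _ _
    have hq2 : (q : ℤ) ∣ 2 * t + 1 := Int.gcd_dvd_right _ _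
    have hgE : (g : ℤ) ∣ (E : ℤ) := ⟨L, hgL.symm⟩
    have hq3 : (q : ℤ) ∣ 3 := dvd_three_of_dvd_of_dvd hq2 ((hq1.trans hgE).trans ht)
    have hq3' : q ∣ 3 := by exact_mod_cast hq3
    rcases (Nat.dvd_prime Nat.prime_three).1 hq3' with h | h
    · exact h
    · exfalso
      have h3g : (3 : ℤ) ∣ (g : ℤ) := by
        have : ((3 : ℕ) : ℤ) ∣ (g : ℤ) := h ▸ hq1
        exact_mod_cast this
      have h3L : (3 : ℤ) ∣ (L : ℤ) := h3g.trans hgdvdL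
      have h9 : (9 : ℤ) ∣ (E : ℤ) := by
        rw [← hgL, show (9 : ℤ) = 3 * 3 by norm_num]
        exact mul_dvd_mul h3g h3L
      exact not_nine_dvd_sq_add_add_one t₀ (h9.trans ht₀)
  have hgj : (g : ℤ) ∣ j := Int.dvd_of_dvd_mul_left_of_gcd_one hg1 hcop
  have hfin : (E : ℤ) ∣ t' - t := by
    rw [← hgL, hj, mul_comm (L : ℤ) j]
    exact mul_dvd_mul hgj dvd_rfl
  exact dvd_sub_comm.1 hfin

/-- **The congruence `t² + t + 1 ≡ 0 (mod E)` has at most `τ(E)` roots** (`E ≥ 1`): for a fixed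
root `t₀`, the map `t ↦ gcd(t - t₀, E)` from the roots to the divisors of `E` is injective
(`dvd_sub_of_gcd_eq`). (The classical count is `∏_{p^k ∥ E} #{roots mod p^k} ≤ 2^{ω(E)}`; the
divisor bound is all that is needed here.) [folklore] -/
theorem card_qroots_one_one_le {E : ℕ} (hE : 0 < E) :
    #(BinQF.qroots 1 1 E) ≤ #E.divisors := by
  rcases (BinQF.qroots 1 1 E).eq_empty_or_nonempty with h0 | ⟨t₀, ht₀⟩
  · simp [h0]
  have hroot : ∀ {M : ℕ}, M ∈ BinQF.qroots 1 1 E → M < E ∧ (E : ℤ) ∣ (M : ℤ) ^ 2 + M + 1 := by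
    intro M hM
    have h := BinQF.mem_qroots.1 hM
    simpa only [one_mul] using h
  obtain ⟨-, ht₀d⟩ := hroot ht₀
  refine Finset.card_le_card_of_injOn (fun t : ℕ => Int.gcd ((t : ℤ) - t₀) E) ?_ ?_
  · intro t _
    simp only [Finset.mem_coe, Nat.mem_divisors]
    exact ⟨Int.natCast_dvd_natCast.1 (Int.gcd_dvd_right ((t : ℤ) - t₀) E), hE.ne'⟩
  · intro t ht t' ht' hdd
    obtain ⟨htE, htd⟩ := hroot ht
    obtain ⟨ht'E, ht'd⟩ := hroot ht'
    have hdvd := dvd_sub_of_gcd_eq hE ht₀d htd ht'd hdd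
    have habs : |(t : ℤ) - t'| < E := by
      rw [abs_lt]
      constructor <;> omega
    have h0 := Int.eq_zero_of_abs_lt_dvd hdvd habs
    exact_mod_cast (sub_eq_zero.1 h0)

/-! ### Proper representations by a definite form: at most `#Aut⁺ · #roots` -/

/-- **Proper representations versus roots.** For a positive definite form `R` of discriminant
`b² - 4e < 0` and `E ≥ 1`, the number of proper representations `E = R(α, γ)`, `gcd(α, γ) = 1`, is
at most `#Aut⁺(R) · #{M mod E : M² + bM + e ≡ 0}`: the root map `v ↦ rootOf R v (mod E)` lands in
the roots (`eval_dvd_rootOf_sq_add`) and each of its fibres is an `Aut⁺(R)`-orbit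
(`card_filter_reps_rootOf_eq`, from the tree's `BinaryQuadraticFormsRoots`).
[cite: Cox2013, §2.A Lemma 2.3 and Thm. 2.8] -/
theorem card_reps_le {b e : ℤ} {R : BinQF} (hR : R.disc = b ^ 2 - 4 * e) (ha : 0 < R.a)
    (hΔ : b ^ 2 - 4 * e < 0) {E : ℕ} (hE : 0 < E) :
    #(BinQF.reps R E) ≤ #R.autSet * #(BinQF.qroots b e E) := by
  classical
  have hD : R.disc < 0 := hR ▸ hΔ
  have hE0 : (E : ℤ) ≠ 0 := by exact_mod_cast hE.ne'
  have hE0' : (0 : ℤ) < E := by exact_mod_cast hE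
  set ρ : ℤ × ℤ → ℕ := fun v => ((BinQF.rootOf b R v) % E).toNat with hρ
  have hρval : ∀ v, ((ρ v : ℕ) : ℤ) = BinQF.rootOf b R v % E := fun v =>
    Int.toNat_of_nonneg (Int.emod_nonneg _ hE0)
  have hmaps : ∀ v ∈ BinQF.reps R E, ρ v ∈ BinQF.qroots b e E := by
    intro v hv
    rw [BinQF.mem_reps ha hD] at hv
    rw [BinQF.mem_qroots]
    constructor
    · have : ((ρ v : ℕ) : ℤ) < E := by rw [hρval]; exact Int.emod_lt_of_pos _ hE0'
      exact_mod_cast this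
    · rw [hρval]
      have h1 := BinQF.eval_dvd_rootOf_sq_add hR hv.2
      rw [hv.1] at h1
      exact BinQF.dvd_quad_of_modEq (Int.mod_modEq _ _).symm h1
  have hfib : ∀ M ∈ BinQF.qroots b e E, #{v ∈ BinQF.reps R E | ρ v = M} ≤ #R.autSet := by
    intro M hM
    rw [BinQF.mem_qroots] at hM
    have hfilter : (BinQF.reps R E).filter (fun v => ρ v = M) =
        (BinQF.reps R E).filter (fun v => BinQF.rootOf b R v ≡ (M : ℤ) [ZMOD E]) := by
      have hME : (M : ℤ) % E = M :=
        Int.emod_eq_of_lt (by exact_mod_cast Nat.zero_le M) (by exact_mod_cast hM.1)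
      refine Finset.filter_congr fun v _ => ?_
      constructor
      · intro h
        have h1 : BinQF.rootOf b R v % E = M := by rw [← hρval, h]
        show BinQF.rootOf b R v % E = (M : ℤ) % E
        rw [h1, hME]
      · intro h
        have h' : BinQF.rootOf b R v % E = (M : ℤ) % E := h
        rw [hME] at h'
        have : ((ρ v : ℕ) : ℤ) = M := by rw [hρval, h']
        exact_mod_cast this
    rw [hfilter]
    rcases ((BinQF.reps R E).filter
        (fun v => BinQF.rootOf b R v ≡ (M : ℤ) [ZMOD E])).eq_empty_or_nonempty with h0 | ⟨v₀, hv₀⟩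
    · rw [h0, Finset.card_empty]
      exact Nat.zero_le _
    · rw [Finset.mem_filter, BinQF.mem_reps ha hD] at hv₀
      obtain ⟨⟨hvE, hvg⟩, hvM⟩ := hv₀
      set m₀ : Mat2 := (BinQF.bz v₀).mul (Mat2.T (((M : ℤ) - BinQF.rootOf b R v₀) / E)) with hm₀def
      have hm₀ : m₀.det = 1 := by
        rw [hm₀def, Mat2.det_mul, BinQF.det_bz hvg, Mat2.det_T, one_mul]
      have hφ : R.actM m₀ = BinQF.formOfRoot b e E M :=
        BinQF.actM_bz_mul_T_eq_formOfRoot hR hE hvE hvg hvM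
      rw [BinQF.card_filter_reps_rootOf_eq hR ha hΔ hE hm₀ hφ]
  rw [Finset.card_eq_sum_card_fiberwise (f := ρ) (t := BinQF.qroots b e E)
    (fun v hv => hmaps v hv)]
  calc ∑ M ∈ BinQF.qroots b e E, #{v ∈ BinQF.reps R E | ρ v = M}
      ≤ ∑ M ∈ BinQF.qroots b e E, #R.autSet := Finset.sum_le_sum hfib
    _ = #R.autSet * #(BinQF.qroots b e E) := by rw [Finset.sum_const, smul_eq_mul, mul_comm]

/-! ### All representations of `m ≥ 1` by `x² + xy + y²`: at most `#Aut⁺ · τ(m)²` -/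

/-- **Representations of `m ≥ 1` by `x² + xy + y²` in a box.** Scaling a representation `(x, y)`
by `g = gcd(x, y)` gives a proper representation of `m/g²` (`g ∣ m`), so by `card_reps_le` and
`card_qroots_one_one_le` the number of `(x, y)` with `x² + xy + y² = m` (in any box) is at most
`τ(m) · #Aut⁺(x²+xy+y²) · τ(m)`. [folklore] -/
theorem card_A2box_le {m : ℕ} (hm : 0 < m) (B : ℤ) :
    #{v ∈ Icc (-B) B ×ˢ Icc (-B) B | v.1 ^ 2 + v.1 * v.2 + v.2 ^ 2 = (m : ℤ)} ≤
      #m.divisors * (#(⟨1, 1, 1⟩ : BinQF).autSet * #m.divisors) := by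
  classical
  set R : BinQF := ⟨1, 1, 1⟩ with hRdef
  have hR : R.disc = 1 ^ 2 - 4 * 1 := by simp [hRdef, BinQF.disc]
  have ha : 0 < R.a := by simp [hRdef]
  have hΔ : (1 : ℤ) ^ 2 - 4 * 1 < 0 := by norm_num
  have hD : R.disc < 0 := by rw [hR]; norm_num
  have heval : ∀ x y : ℤ, R.eval x y = x ^ 2 + x * y + y ^ 2 := by
    intro x y
    simp [hRdef, BinQF.eval]
  set G : Finset ℕ := {g ∈ m.divisors | g ^ 2 ∣ m} with hGdef
  have hsub : {v ∈ Icc (-B) B ×ˢ Icc (-B) B | v.1 ^ 2 + v.1 * v.2 + v.2 ^ 2 = (m : ℤ)} ⊆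
      G.biUnion (fun g => (BinQF.reps R (m / g ^ 2)).image
        (fun v => ((g : ℤ) * v.1, (g : ℤ) * v.2))) := by
    intro v hv
    rw [Finset.mem_filter] at hv
    obtain ⟨-, hv⟩ := hv
    obtain ⟨x, y⟩ := v
    simp only at hv
    have hne : x ≠ 0 ∨ y ≠ 0 := by
      by_contra h
      push Not at h
      obtain ⟨rfl, rfl⟩ := h
      simp at hv
      omega
    set g : ℕ := Int.gcd x y with hgdef
    have hgpos : 0 < g := Int.gcd_pos_iff.2 hne
    obtain ⟨x₁, hx₁⟩ : (g : ℤ) ∣ x := Int.gcd_dvd_left _ _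
    obtain ⟨y₁, hy₁⟩ : (g : ℤ) ∣ y := Int.gcd_dvd_right _ _
    have hcop : Int.gcd x₁ y₁ = 1 := by
      have h1 : Int.gcd x y = g := rfl
      rw [hx₁, hy₁, Int.gcd_mul_left, Int.natAbs_natCast] at h1
      exact (mul_eq_left₀ hgpos.ne').1 h1
    have hm' : (m : ℤ) = (g : ℤ) ^ 2 * (x₁ ^ 2 + x₁ * y₁ + y₁ ^ 2) := by
      rw [← hv, hx₁, hy₁]; ring
    have hg2m : g ^ 2 ∣ m := by
      have : ((g ^ 2 : ℕ) : ℤ) ∣ (m : ℤ) := ⟨x₁ ^ 2 + x₁ * y₁ + y₁ ^ 2, by rw [hm']; push_cast; ring⟩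
      exact_mod_cast this
    have hgm : g ∣ m := (dvd_pow_self g two_ne_zero).trans hg2m
    have hq : ((m / g ^ 2 : ℕ) : ℤ) = x₁ ^ 2 + x₁ * y₁ + y₁ ^ 2 := by
      rw [Int.natCast_div, hm']
      push_cast
      rw [Int.mul_ediv_cancel_left _ (by positivity)]
    rw [Finset.mem_biUnion]
    refine ⟨g, ?_, ?_⟩
    · rw [hGdef, Finset.mem_filter, Nat.mem_divisors]
      exact ⟨⟨hgm, hm.ne'⟩, hg2m⟩
    · rw [Finset.mem_image]
      refine ⟨(x₁, y₁), ?_, ?_⟩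
      · rw [BinQF.mem_reps ha hD]
        exact ⟨by rw [heval, ← hq], hcop⟩
      · simp only [Prod.mk.injEq]
        exact ⟨hx₁.symm, hy₁.symm⟩
  have hper : ∀ g ∈ G, #((BinQF.reps R (m / g ^ 2)).image
      (fun v => ((g : ℤ) * v.1, (g : ℤ) * v.2))) ≤ #R.autSet * #m.divisors := by
    intro g hg
    rw [hGdef, Finset.mem_filter, Nat.mem_divisors] at hg
    obtain ⟨⟨hgm, -⟩, hg2m⟩ := hg
    have hq0 : 0 < m / g ^ 2 := Nat.div_pos (Nat.le_of_dvd hm hg2m) (by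
      have hgpos : 0 < g := Nat.pos_of_dvd_of_pos hgm hm
      positivity)
    calc #((BinQF.reps R (m / g ^ 2)).image (fun v => ((g : ℤ) * v.1, (g : ℤ) * v.2)))
        ≤ #(BinQF.reps R (m / g ^ 2)) := Finset.card_image_le
      _ ≤ #R.autSet * #(BinQF.qroots 1 1 (m / g ^ 2)) := card_reps_le hR ha hΔ hq0
      _ ≤ #R.autSet * #(m / g ^ 2).divisors :=
          Nat.mul_le_mul_left _ (card_qroots_one_one_le hq0)
      _ ≤ #R.autSet * #m.divisors := Nat.mul_le_mul_left _ (Finset.card_le_card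
          (Nat.divisors_subset_of_dvd hm.ne' (Nat.div_dvd_of_dvd hg2m)))
  calc #{v ∈ Icc (-B) B ×ˢ Icc (-B) B | v.1 ^ 2 + v.1 * v.2 + v.2 ^ 2 = (m : ℤ)}
      ≤ #(G.biUnion (fun g => (BinQF.reps R (m / g ^ 2)).image
          (fun v => ((g : ℤ) * v.1, (g : ℤ) * v.2)))) := Finset.card_le_card hsub
    _ ≤ ∑ g ∈ G, #((BinQF.reps R (m / g ^ 2)).image
          (fun v => ((g : ℤ) * v.1, (g : ℤ) * v.2))) := Finset.card_biUnion_le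
    _ ≤ ∑ g ∈ G, #R.autSet * #m.divisors := Finset.sum_le_sum hper
    _ = #G * (#R.autSet * #m.divisors) := by rw [Finset.sum_const, smul_eq_mul]
    _ ≤ #m.divisors * (#R.autSet * #m.divisors) :=
        Nat.mul_le_mul_right _ (Finset.card_filter_le _ _)


/-! ### Triples with given sum and sum of squares -/

/-- `x² + xy + y² ≥ 0`, with equality only at the origin. [folklore] -/
theorem A2_nonneg (x y : ℤ) : 0 ≤ x ^ 2 + x * y + y ^ 2 := by
  nlinarith [sq_nonneg (2 * x + y), sq_nonneg y]

/-- `x² + xy + y² = 0` forces `x = y = 0`. [folklore] -/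
theorem A2_eq_zero {x y : ℤ} (h : x ^ 2 + x * y + y ^ 2 = 0) : x = 0 ∧ y = 0 := by
  have hy : y = 0 := by nlinarith [sq_nonneg (2 * x + y), sq_nonneg y]
  subst hy
  simpa using h

/-- **Triples with prescribed sum and sum of squares.** For `S ⊆ [-N, N]` and `f = (k, l)`, the
number of `(n₁, n₂, n₃) ∈ S³` with `n₁ + n₂ + n₃ = k`, `n₁² + n₂² + n₃² = l` is at most
`1 + #Aut⁺(x²+xy+y²) · (C (12N²)^δ)²` whenever `τ(m) ≤ C m^δ` for all `m ≥ 1`: the map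
`(n₁, n₂, n₃) ↦ (x, y) = (n₁ - n₂, n₂ - n₃)` is injective for fixed `k` and lands in the
representations of `m' = (3l - k²)/2 ≤ 12N²` by `x² + xy + y²` (`card_A2box_le`; `m' = 0` gives
at most one triple). This is the arithmetic input of Bourgain's discrete `L⁶` restriction bound
for the parabola. [cite: BourgainJAMS2017, Remark (1.4)–(1.5)] -/
theorem card_tripleFiber_le {S : Finset ℤ} {N : ℕ} (hS : ∀ n ∈ S, |n| ≤ (N : ℤ)) (f : ℤ × ℤ)
    {C δ : ℝ} (hδ : 0 ≤ δ) (hC0 : 0 ≤ C)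
    (hC : ∀ m : ℕ, m ≠ 0 → (#m.divisors : ℝ) ≤ C * (m : ℝ) ^ δ) :
    (#{t ∈ Fintype.piFinset (fun _ : Fin 3 => S) | (∑ i, t i, ∑ i, t i ^ 2) = f} : ℝ) ≤
      1 + #(⟨1, 1, 1⟩ : BinQF).autSet * (C * (12 * (N : ℝ) ^ 2) ^ δ) ^ 2 := by
  classical
  obtain ⟨T, hT⟩ : ∃ T : Finset (Fin 3 → ℤ),
      T = {t ∈ Fintype.piFinset (fun _ : Fin 3 => S) | (∑ i, t i, ∑ i, t i ^ 2) = f} :=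
    ⟨_, rfl⟩
  rw [← hT]
  have hpos : (0 : ℝ) ≤ #(⟨1, 1, 1⟩ : BinQF).autSet * (C * (12 * (N : ℝ) ^ 2) ^ δ) ^ 2 := by
    positivity
  rcases T.eq_empty_or_nonempty with h0 | ⟨t₀, ht₀⟩
  · rw [h0, Finset.card_empty, Nat.cast_zero]
    linarith
  have hmemT : ∀ t ∈ T, (∀ i, t i ∈ S) ∧ t 0 + t 1 + t 2 = f.1 ∧
      t 0 ^ 2 + t 1 ^ 2 + t 2 ^ 2 = f.2 := by
    intro t ht
    rw [hT, Finset.mem_filter, Fintype.mem_piFinset] at ht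
    obtain ⟨hmem, hf⟩ := ht
    have h1 := congrArg Prod.fst hf
    have h2 := congrArg Prod.snd hf
    simp only [Fin.sum_univ_three] at h1 h2
    exact ⟨hmem, h1, h2⟩
  -- the value `m'` of `x² + xy + y²` on the image is constant on the fibre
  have hval : ∀ t ∈ T, 2 * ((t 0 - t 1) ^ 2 + (t 0 - t 1) * (t 1 - t 2) + (t 1 - t 2) ^ 2) =
      3 * f.2 - f.1 ^ 2 := by
    intro t ht
    obtain ⟨-, hk, hl⟩ := hmemT t ht
    rw [← hk, ← hl]
    ring
  obtain ⟨m', hm'def⟩ : ∃ m' : ℤ,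
      m' = (t₀ 0 - t₀ 1) ^ 2 + (t₀ 0 - t₀ 1) * (t₀ 1 - t₀ 2) + (t₀ 1 - t₀ 2) ^ 2 := ⟨_, rfl⟩
  have hm'nn : 0 ≤ m' := by rw [hm'def]; exact A2_nonneg _ _
  have hbd : ∀ t ∈ T, ∀ i, -(N : ℤ) ≤ t i ∧ t i ≤ N := by
    intro t ht i
    exact abs_le.1 (hS _ ((hmemT t ht).1 i))
  have hbox : ∀ t ∈ T, (t 0 - t 1, t 1 - t 2) ∈
      {v ∈ Icc (-(2 * (N : ℤ))) (2 * N) ×ˢ Icc (-(2 * (N : ℤ))) (2 * N) |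
        v.1 ^ 2 + v.1 * v.2 + v.2 ^ 2 = m'} := by
    intro t ht
    have hqt : (t 0 - t 1) ^ 2 + (t 0 - t 1) * (t 1 - t 2) + (t 1 - t 2) ^ 2 = m' := by
      have h1 := hval t ht
      have h2 := hval t₀ ht₀
      rw [hm'def]
      linarith
    have h0 := hbd t ht 0
    have h1 := hbd t ht 1
    have h2 := hbd t ht 2
    rw [Finset.mem_filter, Finset.mem_product, Finset.mem_Icc, Finset.mem_Icc]
    exact ⟨⟨⟨by linarith, by linarith⟩, by linarith, by linarith⟩, hqt⟩
  have hinj : Set.InjOn (fun t : Fin 3 → ℤ => (t 0 - t 1, t 1 - t 2)) T := by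
    intro t ht t' ht' h
    obtain ⟨-, hk, -⟩ := hmemT t ht
    obtain ⟨-, hk', -⟩ := hmemT t' ht'
    simp only [Prod.mk.injEq] at h
    have e2 : t 2 = t' 2 := by linarith
    have e1 : t 1 = t' 1 := by linarith
    have e0 : t 0 = t' 0 := by linarith
    funext i
    fin_cases i
    · exact e0
    · exact e1
    · exact e2
  have hcard : #T ≤ #{v ∈ Icc (-(2 * (N : ℤ))) (2 * N) ×ˢ Icc (-(2 * (N : ℤ))) (2 * N) |
        v.1 ^ 2 + v.1 * v.2 + v.2 ^ 2 = m'} :=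
    Finset.card_le_card_of_injOn _ (fun t ht => hbox t ht) hinj
  rcases hm'nn.eq_or_lt with hm0 | hm0
  · -- `m' = 0`: only the origin, at most one triple
    have hsub : {v ∈ Icc (-(2 * (N : ℤ))) (2 * N) ×ˢ Icc (-(2 * (N : ℤ))) (2 * N) |
        v.1 ^ 2 + v.1 * v.2 + v.2 ^ 2 = m'} ⊆ {((0 : ℤ), (0 : ℤ))} := by
      intro v hv
      rw [Finset.mem_filter] at hv
      have hq0 : v.1 ^ 2 + v.1 * v.2 + v.2 ^ 2 = 0 := by rw [hv.2, ← hm0]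
      obtain ⟨hx, hy⟩ := A2_eq_zero hq0
      rw [Finset.mem_singleton]
      exact Prod.ext hx hy
    have h1 : #T ≤ 1 :=
      hcard.trans ((Finset.card_le_card hsub).trans (by rw [Finset.card_singleton]))
    have h1' : (#T : ℝ) ≤ 1 := by exact_mod_cast h1
    linarith
  · -- `m' ≥ 1`
    obtain ⟨m, hmm'⟩ : ∃ m : ℕ, (m : ℤ) = m' := ⟨m'.toNat, Int.toNat_of_nonneg hm'nn⟩
    have hmpos : 0 < m := by
      have : (0 : ℤ) < m := hmm' ▸ hm0
      exact_mod_cast this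
    have hmle : (m : ℝ) ≤ 12 * (N : ℝ) ^ 2 := by
      have h0 := hbd t₀ ht₀ 0
      have h1 := hbd t₀ ht₀ 1
      have h2 := hbd t₀ ht₀ 2
      have hle : m' ≤ 12 * (N : ℤ) ^ 2 := by
        rw [hm'def]
        nlinarith
      have : (m : ℤ) ≤ 12 * (N : ℤ) ^ 2 := hmm' ▸ hle
      exact_mod_cast this
    have hA2 := card_A2box_le hmpos (2 * (N : ℤ))
    rw [hmm'] at hA2
    have hA2' : (#T : ℝ) ≤ #m.divisors * (#(⟨1, 1, 1⟩ : BinQF).autSet * #m.divisors) := by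
      exact_mod_cast hcard.trans hA2
    have hτ : (#m.divisors : ℝ) ≤ C * (12 * (N : ℝ) ^ 2) ^ δ :=
      (hC m hmpos.ne').trans
        (mul_le_mul_of_nonneg_left (Real.rpow_le_rpow (by positivity) hmle hδ) hC0)
    have hτ0 : (0 : ℝ) ≤ #m.divisors := Nat.cast_nonneg _
    have hAut0 : (0 : ℝ) ≤ #(⟨1, 1, 1⟩ : BinQF).autSet := Nat.cast_nonneg _
    have hsq : (#m.divisors : ℝ) * #m.divisors ≤
        (C * (12 * (N : ℝ) ^ 2) ^ δ) * (C * (12 * (N : ℝ) ^ 2) ^ δ) :=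
      mul_le_mul hτ hτ hτ0 (hτ0.trans hτ)
    calc (#T : ℝ) ≤ #m.divisors * (#(⟨1, 1, 1⟩ : BinQF).autSet * #m.divisors) := hA2'
      _ = #(⟨1, 1, 1⟩ : BinQF).autSet * ((#m.divisors : ℝ) * #m.divisors) := by ring
      _ ≤ #(⟨1, 1, 1⟩ : BinQF).autSet * ((C * (12 * (N : ℝ) ^ 2) ^ δ) *
          (C * (12 * (N : ℝ) ^ 2) ^ δ)) := mul_le_mul_of_nonneg_left hsq hAut0
      _ = #(⟨1, 1, 1⟩ : BinQF).autSet * (C * (12 * (N : ℝ) ^ 2) ^ δ) ^ 2 := by ring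
      _ ≤ 1 + #(⟨1, 1, 1⟩ : BinQF).autSet * (C * (12 * (N : ℝ) ^ 2) ^ δ) ^ 2 := by linarith


/-! ### The cube of the exponential sum, fibred over `(∑ nᵢ, ∑ nᵢ²)` -/

/-- `(∑_{n∈S} a_n e(nu + n²w))³ = ∑_{(k,l)} c_{k,l} e(ku + lw)` with
`c_{k,l} = ∑_{t ∈ S³, ∑tᵢ = k, ∑tᵢ² = l} ∏ a_{tᵢ}`. [folklore] -/
theorem expSum_pow_three (S : Finset ℤ) (a : ℤ → ℂ) (u w : ℝ) :
    (∑ n ∈ S, a n * Complex.exp (2 * π * I * ↑((n : ℝ) * u + (n : ℝ) ^ 2 * w))) ^ 3 =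
      ∑ f ∈ (Fintype.piFinset fun _ : Fin 3 => S).image (fun t : Fin 3 → ℤ => ((∑ i, t i, ∑ i, t i ^ 2) : ℤ × ℤ)),
        (∑ t ∈ Fintype.piFinset (fun _ : Fin 3 => S) with (∑ i, t i, ∑ i, t i ^ 2) = f,
            ∏ i, a (t i)) *
          Complex.exp (2 * π * I * ↑(((f.1 : ℤ) : ℝ) * u + ((f.2 : ℤ) : ℝ) * w)) := by
  classical
  rw [Finset.sum_pow']
  have hterm : ∀ t ∈ Fintype.piFinset (fun _ : Fin 3 => S),
      ∏ i, (a (t i) * Complex.exp (2 * π * I * ↑(((t i : ℤ) : ℝ) * u + ((t i : ℤ) : ℝ) ^ 2 * w)))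
        = (∏ i, a (t i)) * Complex.exp (2 * π * I *
            ↑((((∑ i, t i : ℤ)) : ℝ) * u + (((∑ i, t i ^ 2 : ℤ)) : ℝ) * w)) := by
    intro t _
    rw [Finset.prod_mul_distrib, ← Complex.exp_sum]
    congr 1
    congr 1
    rw [← Finset.mul_sum]
    congr 1
    push_cast
    simp only [Finset.sum_mul, ← Finset.sum_add_distrib]
  rw [Finset.sum_congr rfl hterm]
  calc ∑ t ∈ Fintype.piFinset (fun _ : Fin 3 => S), (∏ i, a (t i)) * Complex.exp (2 * π * I *
          ↑((((∑ i, t i : ℤ)) : ℝ) * u + (((∑ i, t i ^ 2 : ℤ)) : ℝ) * w))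
      = ∑ f ∈ (Fintype.piFinset fun _ : Fin 3 => S).image (fun t : Fin 3 → ℤ => ((∑ i, t i, ∑ i, t i ^ 2) : ℤ × ℤ)),
          ∑ t ∈ Fintype.piFinset (fun _ : Fin 3 => S) with (∑ i, t i, ∑ i, t i ^ 2) = f,
            (∏ i, a (t i)) * Complex.exp (2 * π * I *
              ↑((((∑ i, t i : ℤ)) : ℝ) * u + (((∑ i, t i ^ 2 : ℤ)) : ℝ) * w)) :=
        (Finset.sum_fiberwise_of_maps_to (fun t ht => Finset.mem_image_of_mem _ ht) _).symm
    _ = ∑ f ∈ (Fintype.piFinset fun _ : Fin 3 => S).image (fun t : Fin 3 → ℤ => ((∑ i, t i, ∑ i, t i ^ 2) : ℤ × ℤ)),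
          ∑ t ∈ Fintype.piFinset (fun _ : Fin 3 => S) with (∑ i, t i, ∑ i, t i ^ 2) = f,
            (∏ i, a (t i)) * Complex.exp (2 * π * I * ↑(((f.1 : ℤ) : ℝ) * u + ((f.2 : ℤ) : ℝ) * w)) := by
        refine Finset.sum_congr rfl fun f _ => Finset.sum_congr rfl fun t ht => ?_
        rw [← (Finset.mem_filter.1 ht).2]
    _ = _ := by
        refine Finset.sum_congr rfl fun f _ => ?_
        rw [Finset.sum_mul]

/-- **Cauchy–Schwarz on the fibres.** If every fibre `{t ∈ S³ : (∑tᵢ, ∑tᵢ²) = f}` has at most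
`r` elements, then `∑_f |c_f|² ≤ r (∑_n |a_n|²)³`. [folklore] -/
theorem sum_normSq_fiber_le (S : Finset ℤ) (a : ℤ → ℂ) {r : ℝ}
    (hr : ∀ f ∈ (Fintype.piFinset fun _ : Fin 3 => S).image (fun t : Fin 3 → ℤ => ((∑ i, t i, ∑ i, t i ^ 2) : ℤ × ℤ)),
      (#{t ∈ Fintype.piFinset (fun _ : Fin 3 => S) | (∑ i, t i, ∑ i, t i ^ 2) = f} : ℝ) ≤ r) :
    ∑ f ∈ (Fintype.piFinset fun _ : Fin 3 => S).image (fun t : Fin 3 → ℤ => ((∑ i, t i, ∑ i, t i ^ 2) : ℤ × ℤ)),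
        ‖∑ t ∈ Fintype.piFinset (fun _ : Fin 3 => S) with (∑ i, t i, ∑ i, t i ^ 2) = f,
            ∏ i, a (t i)‖ ^ 2
      ≤ r * (∑ n ∈ S, ‖a n‖ ^ 2) ^ 3 := by
  classical
  have hstep : ∀ f ∈ (Fintype.piFinset fun _ : Fin 3 => S).image
      (fun t => (∑ i, t i, ∑ i, t i ^ 2)),
      ‖∑ t ∈ Fintype.piFinset (fun _ : Fin 3 => S) with (∑ i, t i, ∑ i, t i ^ 2) = f,
          ∏ i, a (t i)‖ ^ 2 ≤
        r * ∑ t ∈ Fintype.piFinset (fun _ : Fin 3 => S) with (∑ i, t i, ∑ i, t i ^ 2) = f,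
          ∏ i, ‖a (t i)‖ ^ 2 := by
    intro f hf
    have hnn : (0 : ℝ) ≤ ∑ t ∈ Fintype.piFinset (fun _ : Fin 3 => S) with
        (∑ i, t i, ∑ i, t i ^ 2) = f, ‖∏ i, a (t i)‖ ^ 2 :=
      Finset.sum_nonneg fun t _ => by positivity
    calc ‖∑ t ∈ Fintype.piFinset (fun _ : Fin 3 => S) with (∑ i, t i, ∑ i, t i ^ 2) = f,
            ∏ i, a (t i)‖ ^ 2
        ≤ (∑ t ∈ Fintype.piFinset (fun _ : Fin 3 => S) with (∑ i, t i, ∑ i, t i ^ 2) = f,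
            ‖∏ i, a (t i)‖) ^ 2 := pow_le_pow_left₀ (norm_nonneg _) (norm_sum_le _ _) 2
      _ ≤ #{t ∈ Fintype.piFinset (fun _ : Fin 3 => S) | (∑ i, t i, ∑ i, t i ^ 2) = f} *
            ∑ t ∈ Fintype.piFinset (fun _ : Fin 3 => S) with (∑ i, t i, ∑ i, t i ^ 2) = f,
              ‖∏ i, a (t i)‖ ^ 2 := sq_sum_le_card_mul_sum_sq
      _ ≤ r * ∑ t ∈ Fintype.piFinset (fun _ : Fin 3 => S) with (∑ i, t i, ∑ i, t i ^ 2) = f,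
              ‖∏ i, a (t i)‖ ^ 2 := mul_le_mul_of_nonneg_right (hr f hf) hnn
      _ = r * ∑ t ∈ Fintype.piFinset (fun _ : Fin 3 => S) with (∑ i, t i, ∑ i, t i ^ 2) = f,
              ∏ i, ‖a (t i)‖ ^ 2 := by
          congr 1
          refine Finset.sum_congr rfl fun t _ => ?_
          rw [norm_prod, Finset.prod_pow]
  calc ∑ f ∈ (Fintype.piFinset fun _ : Fin 3 => S).image (fun t : Fin 3 → ℤ => ((∑ i, t i, ∑ i, t i ^ 2) : ℤ × ℤ)),
        ‖∑ t ∈ Fintype.piFinset (fun _ : Fin 3 => S) with (∑ i, t i, ∑ i, t i ^ 2) = f,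
            ∏ i, a (t i)‖ ^ 2
      ≤ ∑ f ∈ (Fintype.piFinset fun _ : Fin 3 => S).image (fun t : Fin 3 → ℤ => ((∑ i, t i, ∑ i, t i ^ 2) : ℤ × ℤ)),
          r * ∑ t ∈ Fintype.piFinset (fun _ : Fin 3 => S) with (∑ i, t i, ∑ i, t i ^ 2) = f,
            ∏ i, ‖a (t i)‖ ^ 2 := Finset.sum_le_sum hstep
    _ = r * ∑ t ∈ Fintype.piFinset (fun _ : Fin 3 => S), ∏ i, ‖a (t i)‖ ^ 2 := by
        rw [← Finset.mul_sum, Finset.sum_fiberwise_of_maps_to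
          (fun t ht => Finset.mem_image_of_mem _ ht)]
    _ = r * (∑ n ∈ S, ‖a n‖ ^ 2) ^ 3 := by rw [Finset.sum_pow']

/-- Exponent bookkeeping: `((12N²)^{ε/4})² = 12^{ε/2} N^ε`. [folklore] -/
theorem rpow_twelve_sq_aux {N : ℝ} (hN : 0 ≤ N) (ε : ℝ) :
    ((12 * N ^ 2) ^ (ε / 4)) ^ 2 = (12 : ℝ) ^ (ε / 2) * N ^ ε := by
  have h12 : (0 : ℝ) ≤ 12 * N ^ 2 := by positivity
  rw [← Real.rpow_natCast ((12 * N ^ 2) ^ (ε / 4)) 2, ← Real.rpow_mul h12]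
  have h1 : ε / 4 * ((2 : ℕ) : ℝ) = ε / 2 := by push_cast; ring
  rw [h1, Real.mul_rpow (by norm_num) (by positivity)]
  congr 1
  rw [show (N ^ 2 : ℝ) = N ^ ((2 : ℕ) : ℝ) from (Real.rpow_natCast N 2).symm, ← Real.rpow_mul hN]
  congr 1
  push_cast
  ring

/-! ### The estimate -/

/-- **Bourgain's discrete `L⁶` restriction (periodic Strichartz) estimate for the parabola.**
For every `ε > 0` there is `C = C(ε)` such that for all `N ≥ 1`, all finite `S ⊂ ℤ` with
`|n| ≤ N` on `S`, and all coefficients `a : ℤ → ℂ`,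

  `∫₀¹ ∫₀¹ |∑_{n ∈ S} a_n e(n u + n² w)|⁶ du dw ≤ C N^ε (∑_{n ∈ S} |a_n|²)³`,

i.e. `‖∑_{n ∈ S} a_n e(nu + n²w)‖_{L⁶([0,1]²)} ≤ C^{1/6} N^{ε/6} ‖a‖_{ℓ²(S)}` — "the `L⁶`-norms are
bounded by the `ℓ²`-norms of the coefficients" (Bourgain 2017, end of the proof of (2.10), quoting
the discrete version of (1.5) in Remark (1.4)). Proof: Parseval on `[0,1]²`
(`integral_integral_normSq_expSum`, applied to the cube `expSum_pow_three`), Cauchy–Schwarz on the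
fibres (`sum_normSq_fiber_le`) and the bound `card_tripleFiber_le` for the number of triples with
given `∑ nᵢ`, `∑ nᵢ²` (representations by `x² + xy + y²` and the divisor bound).
[cite: BourgainJAMS2017, Remark (1.4)–(1.5) (discrete version) and §3, proof of (2.10)] -/
theorem discreteRestriction_parabola_L6 {ε : ℝ} (hε : 0 < ε) :
    ∃ C : ℝ, 0 < C ∧ ∀ N : ℕ, 1 ≤ N → ∀ S : Finset ℤ, (∀ n ∈ S, |n| ≤ (N : ℤ)) →
      ∀ a : ℤ → ℂ,
        ∫ u in (0 : ℝ)..1, ∫ w in (0 : ℝ)..1,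
            ‖∑ n ∈ S, a n * Complex.exp (2 * π * I * ↑((n : ℝ) * u + (n : ℝ) ^ 2 * w))‖ ^ 6
          ≤ C * (N : ℝ) ^ ε * (∑ n ∈ S, ‖a n‖ ^ 2) ^ 3 := by
  classical
  have hδ : (0 : ℝ) < ε / 4 := by positivity
  obtain ⟨C, hC1, hC⟩ := Literature.NumberTheory.Sieve.exists_card_divisors_le_mul_rpow hδ
  have hC0 : (0 : ℝ) ≤ C := zero_le_one.trans hC1
  refine ⟨1 + #(⟨1, 1, 1⟩ : BinQF).autSet * C ^ 2 * (12 : ℝ) ^ (ε / 2), by positivity, ?_⟩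
  intro N hN S hS a
  have hN0 : (0 : ℝ) ≤ N := Nat.cast_nonneg N
  have hN1 : (1 : ℝ) ≤ N := by exact_mod_cast hN
  -- the uniform fibre bound
  have hfib : ∀ f ∈ (Fintype.piFinset fun _ : Fin 3 => S).image
      (fun t => (∑ i, t i, ∑ i, t i ^ 2)),
      (#{t ∈ Fintype.piFinset (fun _ : Fin 3 => S) | (∑ i, t i, ∑ i, t i ^ 2) = f} : ℝ) ≤
        1 + #(⟨1, 1, 1⟩ : BinQF).autSet * (C * (12 * (N : ℝ) ^ 2) ^ (ε / 4)) ^ 2 :=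
    fun f _ => card_tripleFiber_le hS f hδ.le hC0 hC
  -- `|F|⁶ = |F³|²` and the cube as an exponential sum over the fibres
  have hpt : ∀ u w : ℝ,
      ‖∑ n ∈ S, a n * Complex.exp (2 * π * I * ↑((n : ℝ) * u + (n : ℝ) ^ 2 * w))‖ ^ 6 =
        ‖∑ f ∈ (Fintype.piFinset fun _ : Fin 3 => S).image (fun t : Fin 3 → ℤ => ((∑ i, t i, ∑ i, t i ^ 2) : ℤ × ℤ)),
          (∑ t ∈ Fintype.piFinset (fun _ : Fin 3 => S) with (∑ i, t i, ∑ i, t i ^ 2) = f,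
              ∏ i, a (t i)) *
            Complex.exp (2 * π * I * ↑(((f.1 : ℤ) : ℝ) * u + ((f.2 : ℤ) : ℝ) * w))‖ ^ 2 := by
    intro u w
    rw [show (6 : ℕ) = 3 * 2 from rfl, pow_mul, ← norm_pow, expSum_pow_three]
  have hint : (∫ u in (0 : ℝ)..1, ∫ w in (0 : ℝ)..1,
      ‖∑ n ∈ S, a n * Complex.exp (2 * π * I * ↑((n : ℝ) * u + (n : ℝ) ^ 2 * w))‖ ^ 6) =
      ∫ u in (0 : ℝ)..1, ∫ w in (0 : ℝ)..1,
        ‖∑ f ∈ (Fintype.piFinset fun _ : Fin 3 => S).image (fun t : Fin 3 → ℤ => ((∑ i, t i, ∑ i, t i ^ 2) : ℤ × ℤ)),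
          (∑ t ∈ Fintype.piFinset (fun _ : Fin 3 => S) with (∑ i, t i, ∑ i, t i ^ 2) = f,
              ∏ i, a (t i)) *
            Complex.exp (2 * π * I * ↑(((f.1 : ℤ) : ℝ) * u + ((f.2 : ℤ) : ℝ) * w))‖ ^ 2 := by
    refine intervalIntegral.integral_congr fun u _ => ?_
    refine intervalIntegral.integral_congr fun w _ => ?_
    exact hpt u w
  rw [hint, integral_integral_normSq_expSum]
  have h1 : (1 : ℝ) ≤ (N : ℝ) ^ ε := Real.one_le_rpow hN1 hε.le
  have hsum0 : (0 : ℝ) ≤ (∑ n ∈ S, ‖a n‖ ^ 2) ^ 3 := by positivity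
  have hAut0 : (0 : ℝ) ≤ #(⟨1, 1, 1⟩ : BinQF).autSet := Nat.cast_nonneg _
  have hA0 : (0 : ℝ) ≤ #(⟨1, 1, 1⟩ : BinQF).autSet * C ^ 2 * (12 : ℝ) ^ (ε / 2) :=
    mul_nonneg (mul_nonneg hAut0 (sq_nonneg C)) (Real.rpow_nonneg (by norm_num) _)
  have hr : 1 + #(⟨1, 1, 1⟩ : BinQF).autSet * (C * (12 * (N : ℝ) ^ 2) ^ (ε / 4)) ^ 2 ≤
      (1 + #(⟨1, 1, 1⟩ : BinQF).autSet * C ^ 2 * (12 : ℝ) ^ (ε / 2)) * (N : ℝ) ^ ε := by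
    rw [mul_pow, rpow_twelve_sq_aux hN0 ε]
    have e : (1 + #(⟨1, 1, 1⟩ : BinQF).autSet * C ^ 2 * (12 : ℝ) ^ (ε / 2)) * (N : ℝ) ^ ε =
        (N : ℝ) ^ ε + #(⟨1, 1, 1⟩ : BinQF).autSet * (C ^ 2 * ((12 : ℝ) ^ (ε / 2) * (N : ℝ) ^ ε)) := by
      ring
    rw [e]
    linarith
  calc ∑ f ∈ (Fintype.piFinset fun _ : Fin 3 => S).image (fun t : Fin 3 → ℤ => ((∑ i, t i, ∑ i, t i ^ 2) : ℤ × ℤ)),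
        ‖∑ t ∈ Fintype.piFinset (fun _ : Fin 3 => S) with (∑ i, t i, ∑ i, t i ^ 2) = f,
            ∏ i, a (t i)‖ ^ 2
      ≤ (1 + #(⟨1, 1, 1⟩ : BinQF).autSet * (C * (12 * (N : ℝ) ^ 2) ^ (ε / 4)) ^ 2) *
          (∑ n ∈ S, ‖a n‖ ^ 2) ^ 3 := sum_normSq_fiber_le S a hfib
    _ ≤ (1 + #(⟨1, 1, 1⟩ : BinQF).autSet * C ^ 2 * (12 : ℝ) ^ (ε / 2)) * (N : ℝ) ^ ε *
          (∑ n ∈ S, ‖a n‖ ^ 2) ^ 3 := mul_le_mul_of_nonneg_right hr hsum0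

/-- The same estimate for sums over natural numbers `n ≤ N` (the shape used in Bourgain 2017,
proof of (2.10): `m < N^{1/4}`). [cite: BourgainJAMS2017, Remark (1.4)–(1.5) and §3, proof of (2.10)] -/
theorem discreteRestriction_parabola_L6_nat {ε : ℝ} (hε : 0 < ε) :
    ∃ C : ℝ, 0 < C ∧ ∀ N : ℕ, 1 ≤ N → ∀ S : Finset ℕ, (∀ n ∈ S, n ≤ N) → ∀ a : ℕ → ℂ,
        ∫ u in (0 : ℝ)..1, ∫ w in (0 : ℝ)..1,
            ‖∑ n ∈ S, a n * Complex.exp (2 * π * I * ↑((n : ℝ) * u + (n : ℝ) ^ 2 * w))‖ ^ 6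
          ≤ C * (N : ℝ) ^ ε * (∑ n ∈ S, ‖a n‖ ^ 2) ^ 3 := by
  obtain ⟨C, hC, h⟩ := discreteRestriction_parabola_L6 hε
  refine ⟨C, hC, fun N hN S hS a => ?_⟩
  have hS' : ∀ z ∈ S.image (fun n : ℕ => (n : ℤ)), |z| ≤ (N : ℤ) := by
    intro z hz
    obtain ⟨n, hn, rfl⟩ := Finset.mem_image.1 hz
    rw [abs_of_nonneg (by positivity)]
    exact_mod_cast hS n hn
  have key := h N hN (S.image (fun n : ℕ => (n : ℤ))) hS' (fun z => a z.toNat)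
  have hinj : Set.InjOn (fun n : ℕ => (n : ℤ)) S := by
    intro x _ y _ hxy
    have hxy' : (x : ℤ) = y := hxy
    exact_mod_cast hxy'
  simpa only [Finset.sum_image hinj, Int.toNat_natCast, Int.cast_natCast] using key

end ParabolaRestriction
end Literature.NumberTheory.LFunctions
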